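import Mathlib.Tactic.NoncommRing

/-!
# Venture HSemireg — fibre test (W³): THE ONE-CLASS TRANSFER LEMMA BEHIND «ONE COMMUTING PAIR SUFFICES»

HONEST FRAMING. Kernel leaf for the computation cell `pub-hsemireg`, (W³) lane (theory seat th-3 gen 45;
file of record `run/shared/lean/pub/pub-hsemireg/theory/TH3-ANTICOMMUTING-DIRECTION.md` §11, legs
`theory/th3/g45/` (scripts k13–k16)). It is STEP (ii) of the pencil proof of th-3 g45's THEOREM E — «if ONE
pair of pencil directions commutes, `[u₁, u₂] = 0`, then `str T = 0` for every KILLING triple of classes,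
at every amplitude» (free-formal at two primes; its amplitude-4 instance is the certificate leaf
`FibreTestW3L4OneCommutingPairCriterion`) —, as a structured ring identity. Nothing in this file
constructs an object on an abelian variety, proves the four-level conjecture (W³)₄, or bears on HC, HC_CM
or HC_AV.

THE SETTING (cell record W3-PATHALG-t5g13 §1, in the presentation of th-3 g45 §11). `R` is any ring (read
`R = End_k(M)` for a graded `M`), `str : R →+ S` any additive map into any additive group that is ODD on
the letters `x, y, p, q, r₁, r₂` (`str (a * w) = -str (w * a)` for every `w`; read: the supertrace and six
odd operators — two commuting pencil directions `x = u₁`, `y = u₂`, the potentials `p = V₁`, `q = V₂` of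
one Killing class, and the index-3 potentials `r₁`, `r₂` of the two other classes, which are FREE here).
Write `X v = x v + v x`, `Y v = y v + v y` on odd arguments and `Y E = y E - E y` on even ones. The
Killing relations (E1) of the class `(p, q, ·)` that are used: `X p = 0`, `Y q = 0`, `Y p + X q = 0`.

THE LEMMA (th-3 g45 §11, ONE-CLASS LEMMA). If `x y = y x`, then
`str ( p · Y( X r₁ · Y r₂ - Y r₁ · X r₂ ) ) = 0`.
By th-3 g45 §11 STEP (i) (three `Y`-transfers), `str T` of a Killing triple with `[u₁, u₂] = 0` is the
cyclic sum over the three classes of exactly this expression (with `(p, q)` the class's own potentials and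
`r₁, r₂` the index-3 potentials of the other two), so the lemma is the whole content of THEOREM E; STEP
(i) is not formalised in this file.

THE PROOF. One `noncomm_ring` identity (`key`, found by th-3 g45's script k16 from the 29-term integer
certificate of k15): `p · Y(M)` equals an explicit integer combination of 29 words `ρ · w` with
`ρ ∈ {[x,y], X p, Y q, Y p + X q}` (13 + 4 + 4 + 8 instances) plus `Σ_a (a · Z_a + Z_a · a)` over the
six letters with explicit `Z_a`; the first group vanishes by the hypotheses, the second under `str` by
oddness.
-/

namespace Summit.Ventures.HSemireg.W3CommutingPairOneClassLemma

/-- THE ONE-CLASS TRANSFER LEMMA of th-3 g45 §11 (STEP (ii) of the pencil proof of THEOREM E «one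
commuting pair suffices for (W³), Killing triples, every amplitude»): for odd letters with `x y = y x` and
the three Killing relations `X p = 0`, `Y q = 0`, `Y p + X q = 0`,
`str (p · Y(X r₁ · Y r₂ - Y r₁ · X r₂)) = 0`. -/
theorem supertrace_transfer_word_eq_zero {R S : Type*} [Ring R] [AddCommGroup S] (str : R →+ S)
    (x y p q r₁ r₂ : R)
    (hxodd : ∀ w : R, str (x * w) = -str (w * x))
    (hyodd : ∀ w : R, str (y * w) = -str (w * y))
    (hr₁odd : ∀ w : R, str (r₁ * w) = -str (w * r₁))
    (hr₂odd : ∀ w : R, str (r₂ * w) = -str (w * r₂))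
    (hxy : x * y - y * x = 0) (hXp : x * p + p * x = 0) (hYq : y * q + q * y = 0)
    (hK : y * p + p * y + x * q + q * x = 0) :
    str (p * (y * ((x * r₁ + r₁ * x) * (y * r₂ + r₂ * y) - (y * r₁ + r₁ * y) * (x * r₂ + r₂ * x)) - ((x
      * r₁ + r₁ * x) * (y * r₂ + r₂ * y) - (y * r₁ + r₁ * y) * (x * r₂ + r₂ * x)) * y)) = 0 := by
  have key :
      p * (y * ((x * r₁ + r₁ * x) * (y * r₂ + r₂ * y) - (y * r₁ + r₁ * y) * (x * r₂ + r₂ * x)) - ((x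
      * r₁ + r₁ * x) * (y * r₂ + r₂ * y) - (y * r₁ + r₁ * y) * (x * r₂ + r₂ * x)) * y)
      =
      ((x * y - y * x) * (p * r₁ * r₂ * y) + (x * y - y * x) * (p * r₁ * y * r₂) - (x * y - y * x)
        * (q * r₁ * r₂ * x) - (x * y - y * x) * (q * r₁ * x * r₂) + (x * y - y * x) * (q * x * r₁ *
        r₂) - (x * y - y * x) * (r₁ * r₂ * p * y) - (x * y - y * x) * (r₁ * r₂ * q * x) - (x * y - y
        * x) * (r₁ * r₂ * x * q) - (x * y - y * x) * (r₁ * r₂ * x * q) - (x * y - y * x) * (r₁ * x *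
        r₂ * q) + (x * y - y * x) * (r₁ * y * r₂ * p) + (x * y - y * x) * (r₂ * q * x * r₁) + (x * y
        - y * x) * (r₂ * x * q * r₁) + (x * y - y * x) * (x * q * r₁ * r₂) - (x * p + p * x) * (r₁ *
        r₂ * y * y) - (x * p + p * x) * (r₁ * y * r₂ * y) + (x * p + p * x) * (y * r₁ * r₂ * y) + (x
        * p + p * x) * (y * r₁ * y * r₂) + (y * p + p * y + x * q + q * x) * (r₁ * r₂ * y * x) + (y
        * p + p * y + x * q + q * x) * (r₁ * x * r₂ * y) + (y * p + p * y + x * q + q * x) * (r₁ * x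
        * y * r₂) - (y * p + p * y + x * q + q * x) * (r₁ * y * x * r₂) + (y * p + p * y + x * q + q
        * x) * (x * y * r₁ * r₂) - (y * p + p * y + x * q + q * x) * (y * r₁ * r₂ * x) - (y * p + p
        * y + x * q + q * x) * (y * r₁ * x * r₂) - (y * p + p * y + x * q + q * x) * (y * x * r₁ *
        r₂) - (y * q + q * y) * (r₁ * r₂ * x * x) - (y * q + q * y) * (r₁ * x * r₂ * x) + (y * q + q
        * y) * (x * r₁ * r₂ * x) + (y * q + q * y) * (x * r₁ * x * r₂))
      +
      ((x * (-p * y * r₁ * r₂ * y - p * y * r₁ * y * r₂ - q * x * r₁ * r₂ * y + q * x * y * r₁ * r₂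
        + q * y * r₁ * r₂ * x + q * y * r₁ * x * r₂ - q * y * x * r₁ * r₂ + r₁ * r₂ * p * y * y + r₁
        * r₂ * q * x * y + r₁ * r₂ * x * q * y + r₁ * r₂ * x * q * y + r₁ * x * r₂ * q * y - r₁ * y
        * r₂ * p * y - r₂ * q * x * r₁ * y - r₂ * q * x * y * r₁ + r₂ * q * y * x * r₁ - r₂ * x * q
        * r₁ * y - x * q * r₁ * r₂ * y - y * p * r₁ * r₂ * y - y * p * r₁ * y * r₂ + y * q * r₁ * r₂
        * x + y * q * r₁ * x * r₂ - y * q * x * r₁ * r₂ + y * r₁ * r₂ * p * y + y * r₁ * r₂ * q * x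
        + y * r₁ * r₂ * x * q + y * r₁ * r₂ * x * q + y * r₁ * x * r₂ * q - y * r₁ * y * r₂ * p - y
        * r₂ * q * x * r₁ - y * r₂ * x * q * r₁ - y * x * q * r₁ * r₂) + (-p * y * r₁ * r₂ * y - p *
        y * r₁ * y * r₂ - q * x * r₁ * r₂ * y + q * x * y * r₁ * r₂ + q * y * r₁ * r₂ * x + q * y *
        r₁ * x * r₂ - q * y * x * r₁ * r₂ + r₁ * r₂ * p * y * y + r₁ * r₂ * q * x * y + r₁ * r₂ * x
        * q * y + r₁ * r₂ * x * q * y + r₁ * x * r₂ * q * y - r₁ * y * r₂ * p * y - r₂ * q * x * r₁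
        * y - r₂ * q * x * y * r₁ + r₂ * q * y * x * r₁ - r₂ * x * q * r₁ * y - x * q * r₁ * r₂ * y
        - y * p * r₁ * r₂ * y - y * p * r₁ * y * r₂ + y * q * r₁ * r₂ * x + y * q * r₁ * x * r₂ - y
        * q * x * r₁ * r₂ + y * r₁ * r₂ * p * y + y * r₁ * r₂ * q * x + y * r₁ * r₂ * x * q + y * r₁
        * r₂ * x * q + y * r₁ * x * r₂ * q - y * r₁ * y * r₂ * p - y * r₂ * q * x * r₁ - y * r₂ * x
        * q * r₁ - y * x * q * r₁ * r₂) * x) + (y * (-p * r₁ * x * r₂ * y - p * r₁ * x * y * r₂ + p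
        * r₁ * y * r₂ * x + p * r₁ * y * x * r₂ - p * x * y * r₁ * r₂ + p * y * r₁ * r₂ * x + p * y
        * r₁ * x * r₂ + p * y * x * r₁ * r₂ - q * x * r₁ * x * r₂ - r₁ * r₂ * p * y * x - r₁ * r₂ *
        q * x * x - r₁ * r₂ * x * q * x - r₁ * r₂ * x * q * x - r₁ * x * r₂ * q * x + r₁ * y * r₂ *
        p * x + r₂ * p * x * y * r₁ - r₂ * p * y * x * r₁ + r₂ * q * x * r₁ * x + r₂ * x * q * r₁ *
        x + x * p * r₁ * r₂ * y + x * p * r₁ * y * r₂ - x * q * r₁ * x * r₂ + x * q * x * r₁ * r₂ -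
        x * r₁ * r₂ * p * y - x * r₁ * r₂ * q * x - x * r₁ * r₂ * x * q - x * r₁ * r₂ * x * q - x *
        r₁ * x * r₂ * q + x * r₁ * y * r₂ * p + x * r₂ * q * x * r₁ + x * r₂ * x * q * r₁ + x * x *
        q * r₁ * r₂) + (-p * r₁ * x * r₂ * y - p * r₁ * x * y * r₂ + p * r₁ * y * r₂ * x + p * r₁ *
        y * x * r₂ - p * x * y * r₁ * r₂ + p * y * r₁ * r₂ * x + p * y * r₁ * x * r₂ + p * y * x *
        r₁ * r₂ - q * x * r₁ * x * r₂ - r₁ * r₂ * p * y * x - r₁ * r₂ * q * x * x - r₁ * r₂ * x * q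
        * x - r₁ * r₂ * x * q * x - r₁ * x * r₂ * q * x + r₁ * y * r₂ * p * x + r₂ * p * x * y * r₁
        - r₂ * p * y * x * r₁ + r₂ * q * x * r₁ * x + r₂ * x * q * r₁ * x + x * p * r₁ * r₂ * y + x
        * p * r₁ * y * r₂ - x * q * r₁ * x * r₂ + x * q * x * r₁ * r₂ - x * r₁ * r₂ * p * y - x * r₁
        * r₂ * q * x - x * r₁ * r₂ * x * q - x * r₁ * r₂ * x * q - x * r₁ * x * r₂ * q + x * r₁ * y
        * r₂ * p + x * r₂ * q * x * r₁ + x * r₂ * x * q * r₁ + x * x * q * r₁ * r₂) * y) + (r₁ * (r₂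
        * p * y * x * y - r₂ * p * y * y * x + r₂ * q * x * x * y - r₂ * q * x * y * x + r₂ * x * q
        * x * y + r₂ * x * q * x * y - r₂ * x * q * y * x - r₂ * x * q * y * x + x * r₂ * q * x * y
        - x * r₂ * q * y * x - y * r₂ * p * x * y + y * r₂ * p * y * x) + (r₂ * p * y * x * y - r₂ *
        p * y * y * x + r₂ * q * x * x * y - r₂ * q * x * y * x + r₂ * x * q * x * y + r₂ * x * q *
        x * y - r₂ * x * q * y * x - r₂ * x * q * y * x + x * r₂ * q * x * y - x * r₂ * q * y * x -
        y * r₂ * p * x * y + y * r₂ * p * y * x) * r₁) + (r₂ * (-p * x * y * r₁ * y + p * y * x * r₁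
        * y - p * y * x * y * r₁ + p * y * y * x * r₁ - q * x * r₁ * x * y + q * x * r₁ * y * x - q
        * x * x * y * r₁ + q * x * y * r₁ * x + q * x * y * x * r₁ - q * y * x * r₁ * x - x * q * r₁
        * x * y + x * q * r₁ * y * x - x * q * x * y * r₁ - x * q * x * y * r₁ + x * q * y * x * r₁
        + x * q * y * x * r₁) + (-p * x * y * r₁ * y + p * y * x * r₁ * y - p * y * x * y * r₁ + p *
        y * y * x * r₁ - q * x * r₁ * x * y + q * x * r₁ * y * x - q * x * x * y * r₁ + q * x * y *
        r₁ * x + q * x * y * x * r₁ - q * y * x * r₁ * x - x * q * r₁ * x * y + x * q * r₁ * y * x -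
        x * q * x * y * r₁ - x * q * x * y * r₁ + x * q * y * x * r₁ + x * q * y * x * r₁) * r₂)) := by
    noncomm_ring
  have hρ :
      ((x * y - y * x) * (p * r₁ * r₂ * y) + (x * y - y * x) * (p * r₁ * y * r₂) - (x * y - y * x)
        * (q * r₁ * r₂ * x) - (x * y - y * x) * (q * r₁ * x * r₂) + (x * y - y * x) * (q * x * r₁ *
        r₂) - (x * y - y * x) * (r₁ * r₂ * p * y) - (x * y - y * x) * (r₁ * r₂ * q * x) - (x * y - y
        * x) * (r₁ * r₂ * x * q) - (x * y - y * x) * (r₁ * r₂ * x * q) - (x * y - y * x) * (r₁ * x *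
        r₂ * q) + (x * y - y * x) * (r₁ * y * r₂ * p) + (x * y - y * x) * (r₂ * q * x * r₁) + (x * y
        - y * x) * (r₂ * x * q * r₁) + (x * y - y * x) * (x * q * r₁ * r₂) - (x * p + p * x) * (r₁ *
        r₂ * y * y) - (x * p + p * x) * (r₁ * y * r₂ * y) + (x * p + p * x) * (y * r₁ * r₂ * y) + (x
        * p + p * x) * (y * r₁ * y * r₂) + (y * p + p * y + x * q + q * x) * (r₁ * r₂ * y * x) + (y
        * p + p * y + x * q + q * x) * (r₁ * x * r₂ * y) + (y * p + p * y + x * q + q * x) * (r₁ * x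
        * y * r₂) - (y * p + p * y + x * q + q * x) * (r₁ * y * x * r₂) + (y * p + p * y + x * q + q
        * x) * (x * y * r₁ * r₂) - (y * p + p * y + x * q + q * x) * (y * r₁ * r₂ * x) - (y * p + p
        * y + x * q + q * x) * (y * r₁ * x * r₂) - (y * p + p * y + x * q + q * x) * (y * x * r₁ *
        r₂) - (y * q + q * y) * (r₁ * r₂ * x * x) - (y * q + q * y) * (r₁ * x * r₂ * x) + (y * q + q
        * y) * (x * r₁ * r₂ * x) + (y * q + q * y) * (x * r₁ * x * r₂)) = 0 := by
    rw [hxy, hXp, hYq, hK]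
    simp
  have hrot : str
      ((x * (-p * y * r₁ * r₂ * y - p * y * r₁ * y * r₂ - q * x * r₁ * r₂ * y + q * x * y * r₁ * r₂
        + q * y * r₁ * r₂ * x + q * y * r₁ * x * r₂ - q * y * x * r₁ * r₂ + r₁ * r₂ * p * y * y + r₁
        * r₂ * q * x * y + r₁ * r₂ * x * q * y + r₁ * r₂ * x * q * y + r₁ * x * r₂ * q * y - r₁ * y
        * r₂ * p * y - r₂ * q * x * r₁ * y - r₂ * q * x * y * r₁ + r₂ * q * y * x * r₁ - r₂ * x * q
        * r₁ * y - x * q * r₁ * r₂ * y - y * p * r₁ * r₂ * y - y * p * r₁ * y * r₂ + y * q * r₁ * r₂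
        * x + y * q * r₁ * x * r₂ - y * q * x * r₁ * r₂ + y * r₁ * r₂ * p * y + y * r₁ * r₂ * q * x
        + y * r₁ * r₂ * x * q + y * r₁ * r₂ * x * q + y * r₁ * x * r₂ * q - y * r₁ * y * r₂ * p - y
        * r₂ * q * x * r₁ - y * r₂ * x * q * r₁ - y * x * q * r₁ * r₂) + (-p * y * r₁ * r₂ * y - p *
        y * r₁ * y * r₂ - q * x * r₁ * r₂ * y + q * x * y * r₁ * r₂ + q * y * r₁ * r₂ * x + q * y *
        r₁ * x * r₂ - q * y * x * r₁ * r₂ + r₁ * r₂ * p * y * y + r₁ * r₂ * q * x * y + r₁ * r₂ * x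
        * q * y + r₁ * r₂ * x * q * y + r₁ * x * r₂ * q * y - r₁ * y * r₂ * p * y - r₂ * q * x * r₁
        * y - r₂ * q * x * y * r₁ + r₂ * q * y * x * r₁ - r₂ * x * q * r₁ * y - x * q * r₁ * r₂ * y
        - y * p * r₁ * r₂ * y - y * p * r₁ * y * r₂ + y * q * r₁ * r₂ * x + y * q * r₁ * x * r₂ - y
        * q * x * r₁ * r₂ + y * r₁ * r₂ * p * y + y * r₁ * r₂ * q * x + y * r₁ * r₂ * x * q + y * r₁
        * r₂ * x * q + y * r₁ * x * r₂ * q - y * r₁ * y * r₂ * p - y * r₂ * q * x * r₁ - y * r₂ * x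
        * q * r₁ - y * x * q * r₁ * r₂) * x) + (y * (-p * r₁ * x * r₂ * y - p * r₁ * x * y * r₂ + p
        * r₁ * y * r₂ * x + p * r₁ * y * x * r₂ - p * x * y * r₁ * r₂ + p * y * r₁ * r₂ * x + p * y
        * r₁ * x * r₂ + p * y * x * r₁ * r₂ - q * x * r₁ * x * r₂ - r₁ * r₂ * p * y * x - r₁ * r₂ *
        q * x * x - r₁ * r₂ * x * q * x - r₁ * r₂ * x * q * x - r₁ * x * r₂ * q * x + r₁ * y * r₂ *
        p * x + r₂ * p * x * y * r₁ - r₂ * p * y * x * r₁ + r₂ * q * x * r₁ * x + r₂ * x * q * r₁ *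
        x + x * p * r₁ * r₂ * y + x * p * r₁ * y * r₂ - x * q * r₁ * x * r₂ + x * q * x * r₁ * r₂ -
        x * r₁ * r₂ * p * y - x * r₁ * r₂ * q * x - x * r₁ * r₂ * x * q - x * r₁ * r₂ * x * q - x *
        r₁ * x * r₂ * q + x * r₁ * y * r₂ * p + x * r₂ * q * x * r₁ + x * r₂ * x * q * r₁ + x * x *
        q * r₁ * r₂) + (-p * r₁ * x * r₂ * y - p * r₁ * x * y * r₂ + p * r₁ * y * r₂ * x + p * r₁ *
        y * x * r₂ - p * x * y * r₁ * r₂ + p * y * r₁ * r₂ * x + p * y * r₁ * x * r₂ + p * y * x *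
        r₁ * r₂ - q * x * r₁ * x * r₂ - r₁ * r₂ * p * y * x - r₁ * r₂ * q * x * x - r₁ * r₂ * x * q
        * x - r₁ * r₂ * x * q * x - r₁ * x * r₂ * q * x + r₁ * y * r₂ * p * x + r₂ * p * x * y * r₁
        - r₂ * p * y * x * r₁ + r₂ * q * x * r₁ * x + r₂ * x * q * r₁ * x + x * p * r₁ * r₂ * y + x
        * p * r₁ * y * r₂ - x * q * r₁ * x * r₂ + x * q * x * r₁ * r₂ - x * r₁ * r₂ * p * y - x * r₁
        * r₂ * q * x - x * r₁ * r₂ * x * q - x * r₁ * r₂ * x * q - x * r₁ * x * r₂ * q + x * r₁ * y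
        * r₂ * p + x * r₂ * q * x * r₁ + x * r₂ * x * q * r₁ + x * x * q * r₁ * r₂) * y) + (r₁ * (r₂
        * p * y * x * y - r₂ * p * y * y * x + r₂ * q * x * x * y - r₂ * q * x * y * x + r₂ * x * q
        * x * y + r₂ * x * q * x * y - r₂ * x * q * y * x - r₂ * x * q * y * x + x * r₂ * q * x * y
        - x * r₂ * q * y * x - y * r₂ * p * x * y + y * r₂ * p * y * x) + (r₂ * p * y * x * y - r₂ *
        p * y * y * x + r₂ * q * x * x * y - r₂ * q * x * y * x + r₂ * x * q * x * y + r₂ * x * q *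
        x * y - r₂ * x * q * y * x - r₂ * x * q * y * x + x * r₂ * q * x * y - x * r₂ * q * y * x -
        y * r₂ * p * x * y + y * r₂ * p * y * x) * r₁) + (r₂ * (-p * x * y * r₁ * y + p * y * x * r₁
        * y - p * y * x * y * r₁ + p * y * y * x * r₁ - q * x * r₁ * x * y + q * x * r₁ * y * x - q
        * x * x * y * r₁ + q * x * y * r₁ * x + q * x * y * x * r₁ - q * y * x * r₁ * x - x * q * r₁
        * x * y + x * q * r₁ * y * x - x * q * x * y * r₁ - x * q * x * y * r₁ + x * q * y * x * r₁
        + x * q * y * x * r₁) + (-p * x * y * r₁ * y + p * y * x * r₁ * y - p * y * x * y * r₁ + p *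
        y * y * x * r₁ - q * x * r₁ * x * y + q * x * r₁ * y * x - q * x * x * y * r₁ + q * x * y *
        r₁ * x + q * x * y * x * r₁ - q * y * x * r₁ * x - x * q * r₁ * x * y + x * q * r₁ * y * x -
        x * q * x * y * r₁ - x * q * x * y * r₁ + x * q * y * x * r₁ + x * q * y * x * r₁) * r₂)) = 0 := by
    simp only [map_add, hxodd, hyodd, hr₁odd, hr₂odd, neg_add_cancel, add_zero]
  rw [key, map_add, hρ, map_zero, zero_add, hrot]

end Summit.Ventures.HSemireg.W3CommutingPairOneClassLemma
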